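import Summits.QuantumFields.BalabanUV.T4Continuum.Support.BlockAverageCurrent
import HarnessLib

/-!
# NE7AxialGaugeStrata — the COMPLETE AXIAL GAUGE `V₀ = U^{v₀}` (tree gauge of [Balaban1985Averaging] p. 24, `B7Prop1Explicit.axialFn`) READ ON ITS STRATA:
# (§1) the plaquette word unfolded; (§2) on the stratum `S_j(y) = {x : x_κ = y_κ for κ < j}` every bond in direction `j` is trivial and, for `ν > j`, the bond
# variables obey the ONE-STEP PLAQUETTE RECURSION `V₀(x + e_j, ν) = V₀(∂p_{jν}(x))·V₀(x, ν)`; (§3) the unitary bookkeeping of the gauge — bond deviation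
# `‖V₀(x, μ) − 1‖ ≤ l1(x − y)·a`, the transported-commutator letter `‖Ad_u X − X‖ ≤ 2‖u − 1‖·‖X − 1‖`, and the PLAIN plaquette difference
# `‖W(∂p(x + e_λ)) − W(∂p(x))‖ ≤ 2b + 2αa` from the covariant flux gradient `b`, the bond deviation `α` and the plaquette radius `a`

Cell `pub-balaban`, rung (B)+1 sub-cell t4, lineage `b2b-balaban-t4-ne7-p1` (CRUX PROVER NE7 #1 = OWNER of BINDER row NE7), generation 111.  Memo
`t4/b2b-balaban-t4-ne7-p1-g111/ROAD-G111.md`.  File F2 of the line «(9)-TYPE k-UNIFORM HÖLDER REGULARITY OF EVERY CONSTRAINED SMALL-FIELD MINIMISER, every β < 1»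
(ROAD-G110 §NEXT (N2)); consumed by F3 `NE7AxialGaugeDerivatives` (descending strata induction for the first and second differences of `V₀`) and F4
`NE7AxialGaugePotential`.
WHAT ([folklore]; 0 def, 0 sorry; every `d`, §1–§2 every group `G`, §3 `U(n) ⊂ M_n(ℂ)`).  `axial_bond_eq_one` (`x ∈ S_j ⟹ V₀(x, j) = 1`, =
`B8Lemma1NonAbelian.axial_treeBond_eq_one` read on the stratum); **`axial_rec`** (`j < ν`, `x ∈ S_j` ⟹ `V₀(x + e_j, ν) = V₀(∂p_{jν}(x))·V₀(x, ν)`);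
`norm_axial_sub_one_le` (`y ≤ x` ⟹ `‖V₀(x, μ) − 1‖ ≤ l1(x − y)·a`, = `axial_bond_bound_sharp` + `l1_lowPart_le`); `norm_Ad_sub_self_le`; **`norm_plaq_diff_le`**.
HONEST FRAMING (page 1): lattice gauge bookkeeping over landed tree theorems ([B7] (8)–(9), the tree gauge of p. 24, the cell's `norm_fwdTransDiff_le_of_covGrad`); nothing
of Bałaban's asserted; NOT NE3∕NE7 as spine nodes; spine 0∕9; finite T⁴ rung (B)+1 — NOT infinite volume, NOT mass gap, NOT BetaPertH, NOT Clay (continuum YM on T⁴ ⇐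
BetaPertH ∧ nine spine estimates).
-/

set_option autoImplicit false

open scoped BigOperators Matrix Matrix.Norms.L2Operator
open NormedSpace Finset

namespace Summit.QuantumFields.BalabanUV.T4Continuum.NE7AxialGaugeStrata

open Literature.MathematicalPhysics.QuantumFieldTheory.Balaban1983to89
open B7Prop1Explicit B7Prop2Explicit MatrixLog UnitaryModel
open B8Lemma1NonAbelian (PlaqSmall lowPart lowPart_apply axial_treeBond_eq_one axial_bond_bound_sharp)
open B8Ineq129 (l1_lowPart_le)
open B7Prop1Local (hol_plaqWord_eq)
open T4AveragingDeficitWall hiding Site Plane Plaq Bond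
open AveragingDeficitTransport (norm_Ad_of_unitary mem_U1_of_unitary)
open AveragingDeficitKDatum (isUnitaryCfg_gaugeAct norm_covGrad_flux_eq_of_gaugeAct)
open BlockAverageCurrent (smallField_gaugeAct norm_fwdTransDiff_le_of_covGrad)

noncomputable section

/-! ## §1 The plaquette word unfolded — the tree's `B7Prop1Local.hol_plaqWord_eq` BY NAME:
`W(∂p_{κμ}(x)) = W(x,κ)·W(x + e_κ, μ)·W(x + e_μ, κ)⁻¹·W(x, μ)⁻¹` ([B7] (9) on the plaquette word; cited, not restated). -/

section Group

variable {d : ℕ} {G : Type*} [Group G]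

/-! ## §2 The strata of the tree gauge -/

/-- **Tree bonds are trivial on the stratum**: if `x_κ = y_κ` for every `κ < j`, the bond `⟨x, x + e_j⟩` of the tree gauge based at `y` carries `1`. [folklore] -/
theorem axial_bond_eq_one (V : Site d → Fin d → G) (y x : Site d) (j : Fin d) (hx : ∀ κ : Fin d, κ < j → x κ = y κ) :
    gaugeAct (axialFn V y) V x j = 1 := by
  apply axial_treeBond_eq_one
  funext κ
  simp only [lowPart_apply, Pi.sub_apply, Pi.zero_apply]
  split_ifs with h
  · rw [hx κ h, sub_self]
  · rfl

/-- **THE ONE-STEP PLAQUETTE RECURSION ON THE STRATUM**: for `j < ν` and `x` with `x_κ = y_κ` (`κ < j`), in the tree gauge `V₀` based at `y`,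
`V₀(x + e_j, ν) = V₀(∂p_{jν}(x))·V₀(x, ν)` — the bonds `⟨x, x+e_j⟩` and `⟨x + e_ν, x + e_ν + e_j⟩` of the plaquette are tree bonds. [folklore] -/
theorem axial_rec (V : Site d → Fin d → G) (y x : Site d) {j ν : Fin d} (hjν : j < ν) (hx : ∀ κ : Fin d, κ < j → x κ = y κ) :
    gaugeAct (axialFn V y) V (x + e j) ν = hol (gaugeAct (axialFn V y) V) x (plaqWord j ν) * gaugeAct (axialFn V y) V x ν := by
  have h1 : gaugeAct (axialFn V y) V x j = 1 := axial_bond_eq_one V y x j hx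
  have h2 : gaugeAct (axialFn V y) V (x + e ν) j = 1 := by
    refine axial_bond_eq_one V y (x + e ν) j fun κ hκ => ?_
    have hκν : κ ≠ ν := fun h => lt_asymm hjν (h ▸ hκ)
    rw [Pi.add_apply, e_apply, if_neg hκν, add_zero, hx κ hκ]
  rw [hol_plaqWord_eq, h1, h2]
  group

/-- The recursion one step BACK along the stratum: `V₀(x, ν) = V₀(∂p_{jν}(x))⁻¹ · V₀(x + e_j, ν)`. [folklore] -/
theorem axial_rec_inv (V : Site d → Fin d → G) (y x : Site d) {j ν : Fin d} (hjν : j < ν) (hx : ∀ κ : Fin d, κ < j → x κ = y κ) :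
    gaugeAct (axialFn V y) V x ν = (hol (gaugeAct (axialFn V y) V) x (plaqWord j ν))⁻¹ * gaugeAct (axialFn V y) V (x + e j) ν := by
  rw [axial_rec V y x hjν hx, inv_mul_cancel_left]

end Group

/-! ## §3 Unitary bookkeeping of the tree gauge -/

section Unitary

variable {d : ℕ} {n : Type*} [Fintype n] [DecidableEq n] [Nonempty n]

omit [Nonempty n] in
/-- The tree gauge function is unitary-valued. [folklore] -/
theorem axialFn_unitary {U : Site d → Fin d → (Matrix n n ℂ)ˣ} (hU : IsUnitaryCfg U) (y z : Site d) :
    axialFn U y z ∈ unitaryUnits (Matrix n n ℂ) :=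
  hol_mem_of (S := unitaryUnits (Matrix n n ℂ)) hU _ _

/-- **Bond deviation in the tree gauge**: for unitary `U` with `SmallField U a` and `y ≤ x`, `‖V₀(x, μ) − 1‖ ≤ l1(x − y)·a`. [folklore] -/
theorem norm_axial_sub_one_le {U : Site d → Fin d → (Matrix n n ℂ)ˣ} (hU : IsUnitaryCfg U) {a : ℝ} (ha : 0 ≤ a) (hS : SmallField U a)
    {y x : Site d} (hyx : y ≤ x) (μ : Fin d) :
    ‖((gaugeAct (axialFn U y) U x μ : (Matrix n n ℂ)ˣ) : Matrix n n ℂ) - 1‖ ≤ (l1 (x - y) : ℝ) * a := by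
  have hU1 : ∀ z κ, U z κ ∈ U1 (Matrix n n ℂ) := fun z κ => mem_U1_of_unitary (hU z κ)
  have hP : PlaqSmall U y (x + e μ) a := fun z κ₁ κ₂ hne _ _ => hS z κ₁ κ₂ hne
  have h := axial_bond_bound_sharp U hU1 hP y x μ le_rfl hyx le_rfl
  refine h.trans (mul_le_mul_of_nonneg_right ?_ ha)
  exact_mod_cast l1_lowPart_le μ (x - y)

/-- **The transported-commutator letter**: `‖Ad_u X − X‖ ≤ 2·‖u − 1‖·‖X − 1‖` for `u ∈ U1` (`Ad_u X − X = (u − 1)(X − 1)u⁻¹ + (X − 1)(u⁻¹ − 1)`). [folklore] -/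
theorem norm_Ad_sub_self_le {u : (Matrix n n ℂ)ˣ} (hu : u ∈ U1 (Matrix n n ℂ)) (X : Matrix n n ℂ) :
    ‖Ad u X - X‖ ≤ 2 * ‖(u : Matrix n n ℂ) - 1‖ * ‖X - 1‖ := by
  have h1 : (u : Matrix n n ℂ) * ((u⁻¹ : (Matrix n n ℂ)ˣ) : Matrix n n ℂ) = 1 := Units.mul_inv u
  have key : ((u : Matrix n n ℂ) - 1) * (X - 1) * ((u⁻¹ : (Matrix n n ℂ)ˣ) : Matrix n n ℂ)
      + (X - 1) * (((u⁻¹ : (Matrix n n ℂ)ˣ) : Matrix n n ℂ) - 1)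
      = (u : Matrix n n ℂ) * X * ((u⁻¹ : (Matrix n n ℂ)ˣ) : Matrix n n ℂ) - X
        + (1 - (u : Matrix n n ℂ) * ((u⁻¹ : (Matrix n n ℂ)ˣ) : Matrix n n ℂ)) := by
    noncomm_ring
  rw [h1, sub_self, add_zero] at key
  have hAd : Ad u X - X = (u : Matrix n n ℂ) * X * ((u⁻¹ : (Matrix n n ℂ)ˣ) : Matrix n n ℂ) - X := rfl
  rw [hAd, ← key]
  have hui : ‖((u⁻¹ : (Matrix n n ℂ)ˣ) : Matrix n n ℂ)‖ ≤ 1 := (mem_U1.mp hu).2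
  have hui1 : ‖((u⁻¹ : (Matrix n n ℂ)ˣ) : Matrix n n ℂ) - 1‖ ≤ ‖(u : Matrix n n ℂ) - 1‖ := norm_inv_sub_one_le hu
  have t1 : ‖((u : Matrix n n ℂ) - 1) * (X - 1) * ((u⁻¹ : (Matrix n n ℂ)ˣ) : Matrix n n ℂ)‖ ≤ ‖(u : Matrix n n ℂ) - 1‖ * ‖X - 1‖ := by
    calc _ ≤ ‖((u : Matrix n n ℂ) - 1) * (X - 1)‖ * ‖((u⁻¹ : (Matrix n n ℂ)ˣ) : Matrix n n ℂ)‖ := norm_mul_le _ _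
      _ ≤ (‖(u : Matrix n n ℂ) - 1‖ * ‖X - 1‖) * 1 := mul_le_mul (norm_mul_le _ _) hui (norm_nonneg _) (by positivity)
      _ = _ := mul_one _
  have t2 : ‖(X - 1) * (((u⁻¹ : (Matrix n n ℂ)ˣ) : Matrix n n ℂ) - 1)‖ ≤ ‖X - 1‖ * ‖(u : Matrix n n ℂ) - 1‖ :=
    (norm_mul_le _ _).trans (mul_le_mul_of_nonneg_left hui1 (norm_nonneg _))
  calc _ ≤ _ + _ := norm_add_le _ _
    _ ≤ ‖(u : Matrix n n ℂ) - 1‖ * ‖X - 1‖ + ‖X - 1‖ * ‖(u : Matrix n n ℂ) - 1‖ := add_le_add t1 t2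
    _ = 2 * ‖(u : Matrix n n ℂ) - 1‖ * ‖X - 1‖ := by ring

/-- **THE PLAIN PLAQUETTE DIFFERENCE** along the bond `⟨x, x + e_λ⟩` of a unitary configuration `W` with `SmallField W a`, `a ≤ 1∕4`: if the covariant flux
gradient there is `≤ b` and `‖W(x, λ) − 1‖ ≤ α`, then `‖W(∂p_{μν}(x + e_λ)) − W(∂p_{μν}(x))‖ ≤ 2b + 2αa`. [folklore] -/
theorem norm_plaq_diff_le {W : Site d → Fin d → (Matrix n n ℂ)ˣ} (hW : IsUnitaryCfg W) {a b α : ℝ} (hS : SmallField W a)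
    (ha4 : a ≤ 1 / 4) (x : Site d) (lam : Fin d) {μ ν : Fin d} (hμν : μ < ν)
    (hb : ‖covGrad W (flux W) x lam ⟨(μ, ν), hμν⟩‖ ≤ b) (hα : ‖((W x lam : (Matrix n n ℂ)ˣ) : Matrix n n ℂ) - 1‖ ≤ α) :
    ‖((hol W (x + e lam) (plaqWord μ ν) : (Matrix n n ℂ)ˣ) : Matrix n n ℂ) - ((hol W x (plaqWord μ ν) : (Matrix n n ℂ)ˣ) : Matrix n n ℂ)‖
      ≤ 2 * b + 2 * α * a := by
  set P' : Matrix n n ℂ := ((hol W (x + e lam) (plaqWord μ ν) : (Matrix n n ℂ)ˣ) : Matrix n n ℂ) with hP'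
  set P : Matrix n n ℂ := ((hol W x (plaqWord μ ν) : (Matrix n n ℂ)ˣ) : Matrix n n ℂ) with hP
  have h1 : ‖Ad (W x lam) P' - P‖ ≤ 2 * b :=
    (norm_fwdTransDiff_le_of_covGrad hW hS ha4 x lam hμν).trans (mul_le_mul_of_nonneg_left hb (by norm_num))
  have ha0 : 0 ≤ a := (norm_nonneg _).trans (hS x μ ν hμν.ne)
  have h2 : ‖Ad (W x lam) P' - P'‖ ≤ 2 * α * a := by
    refine (norm_Ad_sub_self_le (mem_U1_of_unitary (hW x lam)) P').trans ?_
    have hp : ‖P' - 1‖ ≤ a := hS (x + e lam) μ ν hμν.ne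
    have hα0 : 0 ≤ α := (norm_nonneg _).trans hα
    calc 2 * ‖((W x lam : (Matrix n n ℂ)ˣ) : Matrix n n ℂ) - 1‖ * ‖P' - 1‖ ≤ 2 * α * a :=
          mul_le_mul (mul_le_mul_of_nonneg_left hα (by norm_num)) hp (norm_nonneg _) (by positivity)
      _ = _ := rfl
  calc ‖P' - P‖ = ‖(Ad (W x lam) P' - P) - (Ad (W x lam) P' - P')‖ := by congr 1; abel
    _ ≤ ‖Ad (W x lam) P' - P‖ + ‖Ad (W x lam) P' - P'‖ := norm_sub_le _ _
    _ ≤ 2 * b + 2 * α * a := add_le_add h1 h2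

/-- **The tree gauge keeps the class data**: `V₀ = U^{v₀}` is unitary, `SmallField V₀ a`, and its covariant flux gradients have the norms of `U`'s
(for `a < 1`). [folklore] -/
theorem axial_classData {U : Site d → Fin d → (Matrix n n ℂ)ˣ} (hU : IsUnitaryCfg U) {a b : ℝ} (hS : SmallField U a) (ha1 : a < 1)
    (hb : ∀ (x : Site d) (κ : Fin d) (π : T4AveragingDeficitWall.Plane d), ‖covGrad U (flux U) x κ π‖ ≤ b) (y : Site d) :
    IsUnitaryCfg (gaugeAct (axialFn U y) U) ∧ SmallField (gaugeAct (axialFn U y) U) a ∧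
      ∀ (x : Site d) (κ : Fin d) (π : T4AveragingDeficitWall.Plane d),
        ‖covGrad (gaugeAct (axialFn U y) U) (flux (gaugeAct (axialFn U y) U)) x κ π‖ ≤ b := by
  have hu : ∀ z, axialFn U y z ∈ unitaryUnits (Matrix n n ℂ) := axialFn_unitary hU y
  have hS' : SmallField (gaugeAct (axialFn U y) U) a := smallField_gaugeAct hu hS
  refine ⟨isUnitaryCfg_gaugeAct hu hU, hS', fun x κ π => ?_⟩
  have hp : ∀ z : Site d, ‖((fhol (gaugeAct (axialFn U y) U) (z, π) : (Matrix n n ℂ)ˣ) : Matrix n n ℂ) - 1‖ < 1 :=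
    fun z => (hS' z π.1.1 π.1.2 (ne_of_lt π.2)).trans_lt ha1
  rw [← norm_covGrad_flux_eq_of_gaugeAct hu U x κ π (hp x) (hp (x + e κ))]
  exact hb x κ π

end Unitary

end

end Summit.QuantumFields.BalabanUV.T4Continuum.NE7AxialGaugeStrata
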